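import Summits.ResolutionOfSingularities.ResolutionOfSingularities.Theorems.PurelyInseparableDim4PiPlateauOmega
import Literature.AlgebraicGeometry.Resolution.PointBlowupNoConsecutiveJumps
import Literature.AlgebraicGeometry.Resolution.CentreBlowupMohStability
import Literature.Barriers.ResolutionOfSingularities.ResidualOrderUnboundedBlowup
import HarnessLib

/-!
# Ω move law: the `V_q`-inactive half, and `ω_p` does not increase on ANY point blow-up (cell `res-dim4-pi`, Π line)

[OURS · counted 0 · AI kernel work, weaker than expert review]  Nothing here is a statement about resolution of
singularities in dimension ≥ 4 / characteristic `p`, which is NOT proved.  This module completes the ω-corollary of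
the plateau law Π (`Plateau.omegaLetter_step_le`, p661818: `ω_q′ ≤ ω_q` on `V_q`-ACTIVE MODE-0 edges) by the half that
res-dim4-idea-5's OUTCOMES block (1cda6b53f08a322f) files as «rests on print (Moh 1987 (IV); Hauser–Perlega 2019
Thm 1)» — the `V_q`-INACTIVE parent — in the LITERAL letters of `…PiPlateauStatement` (`d = HauserPerlega.residualOrder
Δ F`, `[V_q] = Plateau.IsVActive q Δ F`, edge `CentreBlowup.step q univ j t s`, `t j = 0`; any index type `σ`, every
field of characteristic `p`):

* §1 DICTIONARY.  The MODE-0 child `F′` is the point-blow-up child of `PointBlowupShade.lean` computed from `F` alone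
  (`step_univ_F_eq_pointStep`); read on the LITERAL point state `(F, exceptionalExp Δ F)` the bookkept shade IS the
  literal residual order (`shade_literal_eq`), the child's bookkept exponent is `ρ` of `…PiPlateauBrickData`
  (`pointStep_r_eq_rho`), and `|ρ| ≤ |exceptionalExp Δ′ F′|` gives **`residualOrder_step_le_shade_pointStep`:
  literal `d′ ≤` bookkept shade of the point child** — the one inequality that transfers every UPPER bound of the
  tree's point-blow-up files (`PointBlowupMohBound*`, bookkept letters) to the cell's literal letters.
* §2 MOH IN LITERAL LETTERS.  **`residualOrder_step_le_add_pow`** — `d′ ≤ d + p^{e−1}` on every MODE-0 edge from a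
  clean `q`-fold state, `q = p^e`, every `e ≥ 1` (transfer of `PointBlowup.mohBound`); `step_F_ne_zero_of_isClean`;
  **`isVActive_step_of_residualOrder_lt`** — at `e = 1` a RISE `d < d′` makes the CHILD `V_p`-active (Moh's term `A`,
  tree `PointBlowup.exists_nonexceptional_of_shadeIncreases`: the lost exceptional variable `x_{i₀}`, `t_{i₀} ≠ 0`,
  now non-exceptional, carries an initial monomial with `p ∤ E_{i₀}`); the same at every `e` when `q ∣ ord₀ F′`
  (`isVActive_step_of_residualOrder_lt_of_dvd`, tree `PointBlowup.exists_initial_lowestLayer_of_pow_dvd`);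
  `not_isVActive_of_residualOrder_lt` — a rise forces the PARENT `V_q`-inactive (Π's J0⁺, contrapositive, every
  `e`); **`rise_dictionary`** (`e = 1`): every rise goes `V_p = 0 → V_p = 1` and has size EXACTLY `1`;
  `residualOrder_step_step_le_of_lt` — no two consecutive rises (literal letters, `e = 1`).
* §3 **`omegaLetter_mode0_le` — `ω_p′ ≤ ω_p` ON EVERY MODE-0 EDGE from a clean `p`-fold state (`e = 1`)**, both
  halves (`omegaLetter_step_le_of_not_isVActive` + Π's `omegaLetter_step_le`).
* Sequel `…PiPlateauOmegaChains`: along `Step0 p` chains of the class `(4,1)` `ω_p` is antitone, `d_{k+1} ≤ d_k + 1`,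
  rises are isolated, and Moh's `e = 1` STABILITY `d_m ≤ d_n + 1` (`n ≤ m`) in literal letters.

HONEST LABEL.  `e = 1` shadow, for the class `z^p + F` and (E)-free, of Cossart–Piltant's non-increase of `ω` under
point blow-ups; Moh's bound and term `A` are PRINT ([Moh1987] Stability Theorem and p. 972 «Statement»;
[HauserPerlega2019PRIMS] §3 (9); [Hauser2010] §F–G), kernel-checked in the tree's point-blow-up model by earlier cells
and only TRANSFERRED here; Π is OURS (res-dim4-idea-5, p661587).  `ω_p` is a weakly monotone POINT letter: no strict
decrease is claimed anywhere (standing no-go (C) of the cell: HP cycles / `ResidualOrderUnbounded` live at `e ≥ 2`,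
where only §2's Moh bound and the `q ∣ ord₀ F′` case of term `A` are stated); nothing for coordinate / curve centres;
nothing about termination.  Typed and proved by res-dim4-typ-1 (g2).  Supports stmt-ResolutionOfSingularities-16155
(helper).  bears_on: LADDER-RESOLUTION:D157-DOOR2 (res-dim4-pi · Π line · ω move law).
-/

set_option linter.dupNamespace false -- mandated namespace of this single-conjunct summit

namespace Summit.ResolutionOfSingularities.ResolutionOfSingularities.Theorems.PIDim4

namespace Plateau

open MvPolynomial Finset
open Literature.AlgebraicGeometry.Resolution
open Literature.AlgebraicGeometry.Resolution.Hauser2010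
open Literature.AlgebraicGeometry.Resolution.CentreBlowup
open Literature.Barriers.ResolutionOfSingularities
open Literature.Barriers.ResolutionOfSingularities.HauserPerlega
open Summit.ResolutionOfSingularities.ResolutionOfSingularities.Theorems.Rescue.BedCylinderTransport
  (residualOrder_eq_ordZero_sub forall_le_degree_of_ordZero_eq)

section General

variable {σ : Type*} [Fintype σ] [DecidableEq σ] {K : Type*} [Field K] [DecidableEq K]

/-! ## §1 Dictionary: the MODE-0 edge read on the LITERAL point state `(F, exceptionalExp Δ F)` -/

omit [Fintype σ] [DecidableEq σ] [DecidableEq K] in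
/-- The literal residual order of the zero polynomial is `⊤`. [folklore] -/
theorem residualOrder_zero (Δ : Finset σ) : residualOrder Δ (0 : MvPolynomial σ K) = ⊤ := by
  unfold residualOrder residualFactor
  rw [MvPolynomial.zero_divMonomial, ordZero_zero]

omit [Fintype σ] [DecidableEq σ] [DecidableEq K] in
/-- A state whose literal residual order is exceeded by something is non-zero. [folklore] -/
theorem F_ne_zero_of_residualOrder_lt (s : CState σ K) {x : ℕ∞} (hlt : residualOrder s.exc s.F < x) : s.F ≠ 0 := by
  rintro h0
  rw [h0, residualOrder_zero] at hlt
  exact not_top_lt hlt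

/-- The residual polynomial of a MODE-0 child does not depend on the bookkept multiplicities: it is the
point-blow-up child of `PointBlowupShade.lean` computed from `F` alone. [folklore] -/
theorem step_univ_F_eq_pointStep (q : ℕ) (j : σ) (t : σ → K) (s : CState σ K) (r : σ →₀ ℕ) :
    (CentreBlowup.step q Finset.univ j t s).F =
      (PointBlowup.step q j t (⟨s.F, r⟩ : PointBlowup.State σ K)).F := by
  show deletePthPowers q (PointBlowup.translate t (chartTransform q Finset.univ j s.F)) =
    deletePthPowers q (PointBlowup.translate t (PointBlowup.chartTransform q j s.F))
  rw [chartTransform_univ]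

omit [Fintype σ] in
/-- The bookkept multiplicities of the point-blow-up child of a state `(F, r)` (`ord₀ F = o`, `t j = 0`) are
`ρ = (r_U).update j (o − q)` of `…PiPlateauBrickData`. [folklore] -/
theorem pointStep_r_eq_rho (q : ℕ) {j : σ} {t : σ → K} (ht : t j = 0) (F : MvPolynomial σ K)
    (r : σ →₀ ℕ) {o : ℕ} (ho : ordZero F = o) :
    (PointBlowup.step q j t (⟨F, r⟩ : PointBlowup.State σ K)).r = rho q j t r o := by
  have h := PointBlowup.newMult_eq q j t ht (⟨F, r⟩ : PointBlowup.State σ K) ho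
  ext m
  rw [show (PointBlowup.step q j t (⟨F, r⟩ : PointBlowup.State σ K)).r =
      PointBlowup.newMult q j t ⟨F, r⟩ from rfl, h, rho_apply, Finsupp.filter_apply,
    Finsupp.update_apply]
  by_cases hmj : m = j
  · subst hmj
    rw [if_pos ht, if_pos rfl, if_pos rfl]
  · rw [if_neg hmj, if_neg hmj]

omit [Fintype σ] in
/-- **The literal residual order IS the shade of the literal point state**:
`residualOrder Δ F = shade (F, exceptionalExp Δ F)` (`= ord₀ F − Σ_{i ∈ Δ} ord_{(xᵢ)} F`). [folklore] -/
theorem shade_literal_eq (s : CState σ K) :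
    (⟨s.F, exceptionalExp s.exc s.F⟩ : PointBlowup.State σ K).shade = residualOrder s.exc s.F := by
  by_cases hF0 : s.F = 0
  · have h2 : (⟨s.F, exceptionalExp s.exc s.F⟩ : PointBlowup.State σ K).shade = ⊤ := by
      unfold PointBlowup.State.shade
      rw [show (⟨s.F, exceptionalExp s.exc s.F⟩ : PointBlowup.State σ K).F = s.F from rfl, hF0, ordZero_zero,
        ENat.top_sub_coe]
    rw [h2, hF0, residualOrder_zero]
  obtain ⟨o, ho⟩ := exists_ordZero_eq_natCast hF0
  obtain ⟨-, hd⟩ := residualOrder_eq_ordZero_sub s.exc ho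
  rw [hd]
  exact PointBlowup.shade_eq_of_ordZero_eq (⟨s.F, exceptionalExp s.exc s.F⟩ : PointBlowup.State σ K) ho

/-- **Literal `d′` is at most the bookkept shade of the point child of the literal state** (`t j = 0`, child
non-zero): every monomial of the child is divisible by `x^ρ`, `ρ` the child's bookkept exponent, and `ρ` lives on
`Δ′`, so `|ρ| ≤ |exceptionalExp Δ′ F′|`. [folklore] -/
theorem residualOrder_step_le_shade_pointStep (q : ℕ) {j : σ} {t : σ → K} (ht : t j = 0) (s : CState σ K)
    {o : ℕ} (ho : ordZero s.F = o) (hne : (CentreBlowup.step q Finset.univ j t s).F ≠ 0) :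
    residualOrder (CentreBlowup.step q Finset.univ j t s).exc (CentreBlowup.step q Finset.univ j t s).F ≤
      (PointBlowup.step q j t (⟨s.F, exceptionalExp s.exc s.F⟩ : PointBlowup.State σ K)).shade := by
  have hob : ∀ b ∈ s.F.support, o ≤ b.degree := forall_le_degree_of_ordZero_eq ho le_rfl
  have hFeq := step_univ_F_eq_pointStep q j t s (exceptionalExp s.exc s.F)
  obtain ⟨o', ho'⟩ := exists_ordZero_eq_natCast hne
  have ho'₀ : ordZero (PointBlowup.step q j t (⟨s.F, exceptionalExp s.exc s.F⟩ : PointBlowup.State σ K)).F = o' := by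
    rwa [← hFeq]
  obtain ⟨-, hd'⟩ := residualOrder_eq_ordZero_sub (CentreBlowup.step q Finset.univ j t s).exc ho'
  have hsh₁ : (PointBlowup.step q j t (⟨s.F, exceptionalExp s.exc s.F⟩ : PointBlowup.State σ K)).shade =
      ((o' - (rho q j t (exceptionalExp s.exc s.F) o).degree : ℕ) : ℕ∞) := by
    rw [PointBlowup.shade_eq_of_ordZero_eq _ ho'₀, pointStep_r_eq_rho q ht s.F (exceptionalExp s.exc s.F) ho]
  have hρ := degree_rho_le_degree_exceptionalExp_step q ht s hob hne
  rw [hd', hsh₁, Nat.cast_le]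
  omega

/-! ## §2 Moh's bound and Moh's term `A`, in literal letters -/

/-- **MOH'S ONE-STEP BOUND IN LITERAL LETTERS, every `e ≥ 1`**: on a MODE-0 edge (`t j = 0`) from a CLEAN
`q`-fold state (`q = p^e`), `residualOrder Δ′ F′ ≤ residualOrder Δ F + p^{e−1}` in the letters of
`…PiPlateauStatement` (`Δ′ = (step q univ j t s).exc`), every field of characteristic `p`, any number of variables.
Transfer of the tree's `PointBlowup.mohBound` (bookkept letters of `PointBlowupMohBoundPrimePower.lean`).
[cite: Moh1987, Stability Theorem (one permissible blow-up)] [cite: HauserPerlega2019PRIMS, §3 Theorem (9)] -/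
theorem residualOrder_step_le_add_pow (p : ℕ) [Fact p.Prime] [CharP K p] {e : ℕ} (he : 1 ≤ e)
    (s : CState σ K) (j : σ) (t : σ → K) (ht : t j = 0) (hclean : IsClean (p ^ e) s.F)
    (hq : ((p ^ e : ℕ) : ℕ∞) ≤ ordZero s.F) :
    residualOrder (CentreBlowup.step (p ^ e) Finset.univ j t s).exc (CentreBlowup.step (p ^ e) Finset.univ j t s).F ≤
      residualOrder s.exc s.F + ((p ^ (e - 1) : ℕ) : ℕ∞) := by
  by_cases hF0 : s.F = 0
  · rw [hF0, residualOrder_zero, top_add]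
    exact le_top
  have hr : ∀ b ∈ s.F.support, exceptionalExp s.exc s.F ≤ b :=
    fun b hb => exceptionalExp_le_exponent_of_mem_support s.exc hb
  have hclean' : deletePthPowers (p ^ e) (⟨s.F, exceptionalExp s.exc s.F⟩ : PointBlowup.State σ K).F =
      (⟨s.F, exceptionalExp s.exc s.F⟩ : PointBlowup.State σ K).F := deletePthPowers_eq_self hclean
  obtain ⟨o, ho⟩ := exists_ordZero_eq_natCast hF0
  have hqo : p ^ e ≤ o := by rw [ho] at hq; exact_mod_cast hq
  have hM : (PointBlowup.step (p ^ e) j t (⟨s.F, exceptionalExp s.exc s.F⟩ : PointBlowup.State σ K)).shade ≤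
      (⟨s.F, exceptionalExp s.exc s.F⟩ : PointBlowup.State σ K).shade + ((p ^ (e - 1) : ℕ) : ℕ∞) :=
    PointBlowup.mohBound p he j t ht _ hclean' hq hr
  have hne₀ := PointBlowup.step_F_ne_zero_pow p j t ht
    (⟨s.F, exceptionalExp s.exc s.F⟩ : PointBlowup.State σ K) hclean' ho hqo hr
  have hne : (CentreBlowup.step (p ^ e) Finset.univ j t s).F ≠ 0 := by
    rwa [step_univ_F_eq_pointStep (p ^ e) j t s (exceptionalExp s.exc s.F)]
  rw [shade_literal_eq] at hM
  exact (residualOrder_step_le_shade_pointStep (p ^ e) ht s ho hne).trans hM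

/-- **The child of a non-zero clean `q`-fold state under a MODE-0 edge is never zero** (`q = p^e`; the tree's
`PointBlowup.step_F_ne_zero_pow` read on the literal point state). [folklore] -/
theorem step_F_ne_zero_of_isClean (p : ℕ) [Fact p.Prime] [CharP K p] (e : ℕ) (s : CState σ K) (j : σ)
    (t : σ → K) (ht : t j = 0) (hclean : IsClean (p ^ e) s.F) (hF0 : s.F ≠ 0)
    (hq : ((p ^ e : ℕ) : ℕ∞) ≤ ordZero s.F) : (CentreBlowup.step (p ^ e) Finset.univ j t s).F ≠ 0 := by
  have hr : ∀ b ∈ s.F.support, exceptionalExp s.exc s.F ≤ b :=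
    fun b hb => exceptionalExp_le_exponent_of_mem_support s.exc hb
  have hclean' : deletePthPowers (p ^ e) (⟨s.F, exceptionalExp s.exc s.F⟩ : PointBlowup.State σ K).F =
      (⟨s.F, exceptionalExp s.exc s.F⟩ : PointBlowup.State σ K).F := deletePthPowers_eq_self hclean
  obtain ⟨o, ho⟩ := exists_ordZero_eq_natCast hF0
  have hqo : p ^ e ≤ o := by rw [ho] at hq; exact_mod_cast hq
  have hne₀ := PointBlowup.step_F_ne_zero_pow p j t ht
    (⟨s.F, exceptionalExp s.exc s.F⟩ : PointBlowup.State σ K) hclean' ho hqo hr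
  rwa [step_univ_F_eq_pointStep (p ^ e) j t s (exceptionalExp s.exc s.F)]

/-- A rise of the literal residual order is a rise of the bookkept shade of the literal point state. [folklore] -/
theorem shadeIncreases_pointStep_of_residualOrder_lt (q : ℕ) {j : σ} {t : σ → K} (ht : t j = 0)
    (s : CState σ K) {o : ℕ} (ho : ordZero s.F = o) (hne : (CentreBlowup.step q Finset.univ j t s).F ≠ 0)
    (hlt : residualOrder s.exc s.F <
      residualOrder (CentreBlowup.step q Finset.univ j t s).exc (CentreBlowup.step q Finset.univ j t s).F) :
    PointBlowup.ShadeIncreases q j t (⟨s.F, exceptionalExp s.exc s.F⟩ : PointBlowup.State σ K) := by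
  unfold PointBlowup.ShadeIncreases
  rw [shade_literal_eq]
  exact hlt.trans_le (residualOrder_step_le_shade_pointStep q ht s ho hne)

/-- **MOH'S TERM `A` IN LITERAL LETTERS (`e = 1`)**: if the literal residual order RISES on a MODE-0 edge
(`t j = 0`) from a clean `p`-fold state, the child is `V_p`-ACTIVE — some exceptional component `{x_{i₀} = 0}` lost
at the translated point (`t_{i₀} ≠ 0`, so `i₀ ∉ Δ′`) carries an INITIAL monomial `x^E` of `F′` with `p ∤ E_{i₀}`
(Moh 1987 p. 972 «Statement»: «`F` has a term `A` … now `x_s` is an `X`-kind of variable»; the tree's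
`PointBlowup.exists_nonexceptional_of_shadeIncreases`). [cite: Moh1987, §1 p. 972 (Statement, term A)] -/
theorem isVActive_step_of_residualOrder_lt (p : ℕ) [Fact p.Prime] [CharP K p] (s : CState σ K) (j : σ)
    (t : σ → K) (ht : t j = 0) (hclean : IsClean p s.F) (hq : ((p : ℕ) : ℕ∞) ≤ ordZero s.F)
    (hlt : residualOrder s.exc s.F <
      residualOrder (CentreBlowup.step p Finset.univ j t s).exc (CentreBlowup.step p Finset.univ j t s).F) :
    IsVActive p (CentreBlowup.step p Finset.univ j t s).exc (CentreBlowup.step p Finset.univ j t s).F := by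
  have hF0 : s.F ≠ 0 := F_ne_zero_of_residualOrder_lt s hlt
  have hr : ∀ b ∈ s.F.support, exceptionalExp s.exc s.F ≤ b :=
    fun b hb => exceptionalExp_le_exponent_of_mem_support s.exc hb
  have hclean1 : IsClean (p ^ 1) s.F := by rwa [pow_one]
  have hq1 : ((p ^ 1 : ℕ) : ℕ∞) ≤ ordZero s.F := by rwa [pow_one]
  have hne : (CentreBlowup.step p Finset.univ j t s).F ≠ 0 := by
    have := step_F_ne_zero_of_isClean p 1 s j t ht hclean1 hF0 hq1
    rwa [pow_one] at this
  have hclean' : deletePthPowers p (⟨s.F, exceptionalExp s.exc s.F⟩ : PointBlowup.State σ K).F =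
      (⟨s.F, exceptionalExp s.exc s.F⟩ : PointBlowup.State σ K).F := deletePthPowers_eq_self hclean
  obtain ⟨o, ho⟩ := exists_ordZero_eq_natCast hF0
  have hpo : p ≤ o := by rw [ho] at hq; exact_mod_cast hq
  have hinc := shadeIncreases_pointStep_of_residualOrder_lt p ht s ho hne hlt
  obtain ⟨i₀, -, hti₀, -, -, o₁, ho₁, -, E, hE, hEdeg, hEi₀, -⟩ :=
    PointBlowup.exists_nonexceptional_of_shadeIncreases p j t ht _ hclean' ho hpo hr hinc
  have hFeq := step_univ_F_eq_pointStep p j t s (exceptionalExp s.exc s.F)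
  refine ⟨E, by rwa [hFeq], ?_, i₀, not_mem_exc_step_of_ne_zero p ht s hti₀, hEi₀⟩
  rw [hFeq, ho₁]
  exact_mod_cast hEdeg

/-- **Term `A` at every `e` when `q ∣ ord₀ F′`** (the tree's `PointBlowup.exists_initial_lowestLayer_of_pow_dvd`):
a rise of the literal residual order on a MODE-0 edge from a clean `q`-fold state (`q = p^e`) whose child has order
divisible by `q` makes the child `V_q`-active. [cite: Moh1987, §1 p. 972 (Statement, term A)] -/
theorem isVActive_step_of_residualOrder_lt_of_dvd (p : ℕ) [Fact p.Prime] [CharP K p] (e : ℕ) (s : CState σ K)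
    (j : σ) (t : σ → K) (ht : t j = 0) (hclean : IsClean (p ^ e) s.F) (hq : ((p ^ e : ℕ) : ℕ∞) ≤ ordZero s.F)
    (hlt : residualOrder s.exc s.F <
      residualOrder (CentreBlowup.step (p ^ e) Finset.univ j t s).exc (CentreBlowup.step (p ^ e) Finset.univ j t s).F)
    {o₁ : ℕ} (ho₁ : ordZero (CentreBlowup.step (p ^ e) Finset.univ j t s).F = o₁) (hdvd : p ^ e ∣ o₁) :
    IsVActive (p ^ e) (CentreBlowup.step (p ^ e) Finset.univ j t s).exc
      (CentreBlowup.step (p ^ e) Finset.univ j t s).F := by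
  have hF0 : s.F ≠ 0 := F_ne_zero_of_residualOrder_lt s hlt
  have hr : ∀ b ∈ s.F.support, exceptionalExp s.exc s.F ≤ b :=
    fun b hb => exceptionalExp_le_exponent_of_mem_support s.exc hb
  have hne : (CentreBlowup.step (p ^ e) Finset.univ j t s).F ≠ 0 :=
    step_F_ne_zero_of_isClean p e s j t ht hclean hF0 hq
  have hclean' : deletePthPowers (p ^ e) (⟨s.F, exceptionalExp s.exc s.F⟩ : PointBlowup.State σ K).F =
      (⟨s.F, exceptionalExp s.exc s.F⟩ : PointBlowup.State σ K).F := deletePthPowers_eq_self hclean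
  obtain ⟨o, ho⟩ := exists_ordZero_eq_natCast hF0
  have hqo : p ^ e ≤ o := by rw [ho] at hq; exact_mod_cast hq
  have hinc := shadeIncreases_pointStep_of_residualOrder_lt (p ^ e) ht s ho hne hlt
  have hFeq := step_univ_F_eq_pointStep (p ^ e) j t s (exceptionalExp s.exc s.F)
  have ho₁' : ordZero (PointBlowup.step (p ^ e) j t (⟨s.F, exceptionalExp s.exc s.F⟩ : PointBlowup.State σ K)).F =
      o₁ := by rwa [← hFeq]
  obtain ⟨i₀, -, hti₀, -, -, E, hE, hEdeg, -, hEi₀, -⟩ :=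
    PointBlowup.exists_initial_lowestLayer_of_pow_dvd p j t ht _ hclean' ho hqo hr hinc ho₁' hdvd
  refine ⟨E, by rwa [hFeq], ?_, i₀, not_mem_exc_step_of_ne_zero (p ^ e) ht s hti₀, hEi₀⟩
  rw [ho₁]
  exact_mod_cast hEdeg

/-- **No rise from a `V_q`-active parent** (Π's first half, contrapositive; every `e`): a rise of the literal
residual order on a MODE-0 edge from a `q`-fold state forces the PARENT to be `V_q`-INACTIVE. [folklore] -/
theorem not_isVActive_of_residualOrder_lt (p : ℕ) [Fact p.Prime] [CharP K p] (e : ℕ) (s : CState σ K) (j : σ)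
    (t : σ → K) (ht : t j = 0) (hq : ((p ^ e : ℕ) : ℕ∞) ≤ ordZero s.F)
    (hlt : residualOrder s.exc s.F <
      residualOrder (CentreBlowup.step (p ^ e) Finset.univ j t s).exc (CentreBlowup.step (p ^ e) Finset.univ j t s).F) :
    ¬ IsVActive (p ^ e) s.exc s.F := fun hV =>
  absurd (pi_of_isVActive p e s j t ht hq hV).2.1 (not_le.mpr hlt)

/-- **THE RISE DICTIONARY AT `e = 1`**: on a MODE-0 edge (`t j = 0`) from a clean `p`-fold state, a RISE of the
literal residual order goes from a `V_p`-INACTIVE parent to a `V_p`-ACTIVE child and has size EXACTLY `1`.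
[folklore] -/
theorem rise_dictionary (p : ℕ) [Fact p.Prime] [CharP K p] (s : CState σ K) (j : σ) (t : σ → K) (ht : t j = 0)
    (hclean : IsClean p s.F) (hq : ((p : ℕ) : ℕ∞) ≤ ordZero s.F)
    (hlt : residualOrder s.exc s.F <
      residualOrder (CentreBlowup.step p Finset.univ j t s).exc (CentreBlowup.step p Finset.univ j t s).F) :
    ¬ IsVActive p s.exc s.F ∧
      IsVActive p (CentreBlowup.step p Finset.univ j t s).exc (CentreBlowup.step p Finset.univ j t s).F ∧
      residualOrder (CentreBlowup.step p Finset.univ j t s).exc (CentreBlowup.step p Finset.univ j t s).F =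
        residualOrder s.exc s.F + 1 := by
  have hq1 : ((p ^ 1 : ℕ) : ℕ∞) ≤ ordZero s.F := by rwa [pow_one]
  have hclean1 : IsClean (p ^ 1) s.F := by rwa [pow_one]
  refine ⟨?_, isVActive_step_of_residualOrder_lt p s j t ht hclean hq hlt, ?_⟩
  · have h := not_isVActive_of_residualOrder_lt p 1 s j t ht hq1 (by rwa [pow_one])
    rwa [pow_one] at h
  · have hA := residualOrder_step_le_add_pow p le_rfl s j t ht hclean1 hq1
    simp only [pow_one, Nat.sub_self, pow_zero, Nat.cast_one] at hA
    have hF0 : s.F ≠ 0 := F_ne_zero_of_residualOrder_lt s hlt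
    have hne : (CentreBlowup.step p Finset.univ j t s).F ≠ 0 := by
      have := step_F_ne_zero_of_isClean p 1 s j t ht hclean1 hF0 hq1
      rwa [pow_one] at this
    obtain ⟨o, ho⟩ := exists_ordZero_eq_natCast hF0
    obtain ⟨-, hd⟩ := residualOrder_eq_ordZero_sub s.exc ho
    obtain ⟨o', ho'⟩ := exists_ordZero_eq_natCast hne
    obtain ⟨-, hd'⟩ := residualOrder_eq_ordZero_sub (CentreBlowup.step p Finset.univ j t s).exc ho'
    rw [hd, hd'] at hlt hA ⊢
    rw [show (1 : ℕ∞) = ((1 : ℕ) : ℕ∞) from rfl, ← ENat.coe_add, Nat.cast_le] at hA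
    rw [Nat.cast_lt] at hlt
    rw [show (1 : ℕ∞) = ((1 : ℕ) : ℕ∞) from rfl, ← ENat.coe_add, Nat.cast_inj]
    omega

/-- **No two consecutive rises, literal letters (`e = 1`)**: if the literal residual order rises on a MODE-0 edge
from a clean `p`-fold state, it does not rise on the next MODE-0 edge (the child is `V_p`-active, and Π forbids a rise
from a `V_p`-active state) — Hauser's «a kangaroo point is never followed by a kangaroo point» for the cell's walk
states. [cite: Hauser2010, §G (kangaroo points)] -/
theorem residualOrder_step_step_le_of_lt (p : ℕ) [Fact p.Prime] [CharP K p] (s : CState σ K) (j : σ)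
    (t : σ → K) (ht : t j = 0) (hclean : IsClean p s.F) (hq : ((p : ℕ) : ℕ∞) ≤ ordZero s.F)
    (hlt : residualOrder s.exc s.F <
      residualOrder (CentreBlowup.step p Finset.univ j t s).exc (CentreBlowup.step p Finset.univ j t s).F)
    (j' : σ) (t' : σ → K) (ht' : t' j' = 0)
    (hq' : ((p : ℕ) : ℕ∞) ≤ ordZero (CentreBlowup.step p Finset.univ j t s).F) :
    residualOrder (CentreBlowup.step p Finset.univ j' t' (CentreBlowup.step p Finset.univ j t s)).exc
        (CentreBlowup.step p Finset.univ j' t' (CentreBlowup.step p Finset.univ j t s)).F ≤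
      residualOrder (CentreBlowup.step p Finset.univ j t s).exc (CentreBlowup.step p Finset.univ j t s).F := by
  have hV' := isVActive_step_of_residualOrder_lt p s j t ht hclean hq hlt
  have hq1 : ((p ^ 1 : ℕ) : ℕ∞) ≤ ordZero (CentreBlowup.step p Finset.univ j t s).F := by rwa [pow_one]
  have hV1 : IsVActive (p ^ 1) (CentreBlowup.step p Finset.univ j t s).exc (CentreBlowup.step p Finset.univ j t s).F := by
    rwa [pow_one]
  have h := (pi_of_isVActive p 1 _ j' t' ht' hq1 hV1).2.1
  rwa [pow_one] at h

/-! ## §3 The letter `ω_p = d − [V_p]` does not increase on ANY MODE-0 edge (`e = 1`) -/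

/-- **Ω, THE `V_p`-INACTIVE HALF (`e = 1`)**: on a MODE-0 edge (`t j = 0`) from a clean `p`-fold `V_p`-INACTIVE
state, `ω_p′ ≤ ω_p` (`ω = d` at the parent; either `d′ ≤ d`, or `d′ = d + 1` and then `V_p′ = 1`, `ω′ = d`).
[folklore] -/
theorem omegaLetter_step_le_of_not_isVActive (p : ℕ) [Fact p.Prime] [CharP K p] (s : CState σ K) (j : σ)
    (t : σ → K) (ht : t j = 0) (hclean : IsClean p s.F) (hq : ((p : ℕ) : ℕ∞) ≤ ordZero s.F)
    (hV : ¬ IsVActive p s.exc s.F) :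
    omegaLetter p (CentreBlowup.step p Finset.univ j t s).exc (CentreBlowup.step p Finset.univ j t s).F ≤
      omegaLetter p s.exc s.F := by
  unfold omegaLetter
  rw [if_neg hV, tsub_zero]
  by_cases hF0 : s.F = 0
  · rw [hF0, residualOrder_zero]
    exact le_top
  by_cases hlt : residualOrder s.exc s.F <
      residualOrder (CentreBlowup.step p Finset.univ j t s).exc (CentreBlowup.step p Finset.univ j t s).F
  · obtain ⟨-, hV', heq⟩ := rise_dictionary p s j t ht hclean hq hlt
    obtain ⟨o, ho⟩ := exists_ordZero_eq_natCast hF0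
    obtain ⟨-, hd⟩ := residualOrder_eq_ordZero_sub s.exc ho
    rw [if_pos hV', heq, hd, show (1 : ℕ∞) = ((1 : ℕ) : ℕ∞) from rfl, ← ENat.coe_add, ← ENat.coe_sub,
      Nat.add_sub_cancel]
  · rw [not_lt] at hlt
    exact (tsub_le_self).trans hlt

/-- **Ω — `ω_p` DOES NOT INCREASE ON ANY MODE-0 EDGE (`e = 1`)**: for every field of characteristic `p`, any
number of variables, every clean `p`-fold state `(F, r, Δ)` and every point blow-up edge (`t j = 0`):
`ω_p(F′, Δ′) ≤ ω_p(F, Δ)`, `ω_p = d − [V_p]`.  The `V_p`-active half is Π (`omegaLetter_step_le`, res-dim4-idea-5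
CARD I-5-5, p661818); the `V_p`-inactive half is Moh's bound `+1` with Moh's term `A`.  A weakly monotone POINT
letter; no decrease is claimed (standing no-go (C)); nothing for coordinate centres; nothing about termination.
[folklore] -/
theorem omegaLetter_mode0_le (p : ℕ) [Fact p.Prime] [CharP K p] (s : CState σ K) (j : σ) (t : σ → K)
    (ht : t j = 0) (hclean : IsClean p s.F) (hq : ((p : ℕ) : ℕ∞) ≤ ordZero s.F) :
    omegaLetter p (CentreBlowup.step p Finset.univ j t s).exc (CentreBlowup.step p Finset.univ j t s).F ≤
      omegaLetter p s.exc s.F := by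
  by_cases hV : IsVActive p s.exc s.F
  · have hq1 : ((p ^ 1 : ℕ) : ℕ∞) ≤ ordZero s.F := by rwa [pow_one]
    have hV1 : IsVActive (p ^ 1) s.exc s.F := by rwa [pow_one]
    have h := omegaLetter_step_le p 1 s j t ht hq1 hV1
    rwa [pow_one] at h
  · exact omegaLetter_step_le_of_not_isVActive p s j t ht hclean hq hV

end General

end Plateau

end Summit.ResolutionOfSingularities.ResolutionOfSingularities.Theorems.PIDim4
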